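import Mathlib
import HarnessLib
import Literature.Probability.LatticeModels.ProductMeasureTools
import Summits.Ventures.LatticeQCDFlow.TrivializingMaps.MapLocality

/-!
HONEST FRAMING: exact (Metropolis-corrected) sampling algorithms for lattice gauge theory; figures of
merit are autocorrelation/cost numbers at stated couplings and volumes; no continuum-physics claim.

# FiniteRangeDecorrelation — PROPOSITION R of THEORY-1.md §13.5: the exact light cone of a finite-range
# field map forces EXACT decorrelation beyond twice the range (a no-go for exact finite-range
# trivializing maps, and a range lower bound for ε-exact ones)

Proposed tree path: `Summits/Ventures/LatticeQCDFlow/TrivializingMaps/FiniteRangeDecorrelation.lean`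
(OURS — venture work, never `Literature/`). Cell `lqcd-flow` (pub-lqcd), unit `pub-lqcd-theory1-g11`,
2026-08-21.  Imports: Mathlib, HarnessLib (tags), `Literature.Probability.LatticeModels.ProductMeasureTools`
(the folklore block-independence lemma, REUSED not re-proved) + `MapLocality` (in tree).  Everything PROVED, 0 sorries.

## Setting
Links `ι` (a `Fintype`), link variables `α`, i.i.d. inputs `V : ι → α` with law
`Measure.pi fun _ => μ₀` (for the venture: `μ₀ = haarProbability G`, the product Haar measure of
`Literature…Luscher2010.TrivializingMaps`).  A field map `Φ : (ι → α) → (ι → α)` has READ-SETS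
`N : ι → Set ι` (`MapLocality`: `DependsOn (fun W => Φ W i) (N i)`); every Euler-integrated truncated
trivializing map is of this kind with `N i ⊆ ball(i, r)`, `r = depth × (order + 1)`
(`MapLocality.dependsOn_iterate_ball`).

## What is here
* `readClosure N S = ⋃ i ∈ S, N i` and `DependsOn.comp_fieldMap`: an output observable supported on `S`
  reads, through `Φ`, only the inputs in `readClosure N S`.
* `disjoint_readClosure_of_separated`: for a distance-like `d` (symmetric, triangle inequality), read-sets
  in `r`-balls and supports at `d`-distance `> 2 r` have DISJOINT read-closures.
* `integral_mul_eq_of_dependsOn_sets`: independence of disjoint coordinate blocks under the product law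
  (the tree's `Literature.Probability.LatticeModels.integral_mul_eq_of_dependsOn_disjoint`, `Set`
  supports, `Measure.pi` form).
* **PROPOSITION R, exact part** `pushforward_integral_mul_eq`: under the push-forward law `Φ_* (⊗ μ₀)` two
  bounded measurable observables with disjoint read-closures are EXACTLY uncorrelated; range form
  `pushforward_integral_mul_eq_of_range` (supports `2 r`-separated); Euler-depth form
  `pushforward_iterate_integral_mul_eq` (`F^[n]` of a range-`R` step: separation `> 2 n R`).
* **PROPOSITION R, no-go** `ne_pushforward_of_integral_mul_ne`: a target law `π` with ONE non-vanishing
  connected two-point function at separation `> 2 r` is not `Φ_* (⊗ μ₀)` for ANY map of range `r` — an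
  exact trivializing map of a target with correlation length `ξ > 0` on a torus of diameter `D` has range
  `≥ D / 2` in every direction in which a connected correlator is non-zero.
* **PROPOSITION R, ε-version** `IntegralClose` (dual / bounded-observable distance `≤ ε`; for probability
  laws this is `2·TV`, the quantity an exactness test controls) and
  `abs_cov_le_of_integralClose_pushforward`: if `π` is `ε`-close to `Φ_* (⊗ μ₀)` with `Φ` of range `r`,
  then `|Cov_π(A, B)| ≤ 3 ε a b` for `|A| ≤ a`, `|B| ≤ b` supported `> 2 r` apart; contrapositive
  `exists_close_pair_of_cov_gt`: a connected correlator exceeding `3 ε a b` forces separation `≤ 2 r`,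
  i.e. RANGE `r ≥ sep / 2` (`sep_le_two_mul_range`: any lower bound `m > 3 ε a b` on the connected
  correlator at separation `sep` gives `sep ≤ 2 r`).  With `m = c e^{-sep/ξ}` this is the "footprint
  ≳ ξ log(c/3ε)" statement of THEORY-1 §13.5, to be set against the constructive range
  `O(depth · log V)` of §12.5.

RELATED TREE RESULTS (theory-2, cross-referenced, nothing imported): the exact light-cone factorisation is
also in the tree as T2-G `Scaling/LocalFlows.lean` — `Theory2.indepFun_restrict_of_isLocalMap` /
`map_prod_eq_prod_map_of_isLocalMap` (independence of the restrictions to two blocks with disjoint Finset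
receptive fields, for `IsLocalMap N T`, via Mathlib `iIndepFun_pi`); the present file states the
COVARIANCE form over `DependsOn`/`Set` supports and metric ranges — the form the no-go, the ε-version and
the quasi-local sequel consume — and takes block independence from the Literature lemma
`integral_mul_eq_of_dependsOn_disjoint`; either exact statement can be derived from the other
(`IsLocalMap N T ↔ ∀ i, DependsOn (fun W => T W i) ↑(N i)`).  The finite-probability-space form of the
`3 ε = 6·TV` covariance estimate is theory-2's `Scaling/CovDefect.abs_cov_le_tvDist_prodLaw`; here it is
measure-theoretic and combined with the light cone.  New relative to both: the metric no-go, the ε-exact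
footprint law, and PROPOSITION R′.

* PROPOSITION R′ (quasi-local maps — correlations of an exactly trivialized law decay at least as fast
  as the map's locality tail) is the sequel file `QuasiLocalDecorrelation.lean`.

No statement here is specific to gauge theories: it is the measure-theoretic skeleton (block factors of
an i.i.d. field are finitely dependent), typed so that the venture's Wilson/Haar objects instantiate it
(`ι = Edge d L`, `α = G`, `μ₀ = haarProbability G`, `d` = plaquette/graph distance on the torus).
-/

namespace Summit.Ventures.LatticeQCDFlow.TrivializingMaps

open MeasureTheory ProbabilityTheory Set

/-! ## Read-closures of supports -/

section ReadClosure

variable {ι α β : Type*}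

/-- The READ-CLOSURE of a set `S` of output links under the read-sets `N`: all input links read by some
output link in `S` (the one-step case of `MapLocality.reach`). [folklore] -/
def readClosure (N : ι → Set ι) (S : Set ι) : Set ι := ⋃ i ∈ S, N i

/-- Membership in a read-closure. -/
theorem mem_readClosure {N : ι → Set ι} {S : Set ι} {k : ι} :
    k ∈ readClosure N S ↔ ∃ i ∈ S, k ∈ N i := by
  simp only [readClosure, mem_iUnion, exists_prop]

/-- Read-closures are monotone in the support. -/
theorem readClosure_mono (N : ι → Set ι) {S S' : Set ι} (h : S ⊆ S') :
    readClosure N S ⊆ readClosure N S' := by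
  intro k hk
  obtain ⟨i, hi, hk⟩ := mem_readClosure.1 hk
  exact mem_readClosure.2 ⟨i, h hi, hk⟩

/-- **An output observable reads the read-closure of its support.**  If `Φ · i` depends only on the inputs
in `N i` and the observable `A` of the output field depends only on the output links in `S`, then
`A ∘ Φ` depends only on the inputs in `readClosure N S`. -/
theorem DependsOn.comp_fieldMap {Φ : (ι → α) → (ι → α)} {N : ι → Set ι}
    (hΦ : ∀ i, DependsOn (fun W => Φ W i) (N i)) {A : (ι → α) → β} {S : Set ι}
    (hA : DependsOn A S) : DependsOn (fun W => A (Φ W)) (readClosure N S) := by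
  intro W W' h
  apply hA
  intro i hi
  exact hΦ i fun k hk => h k (mem_readClosure.2 ⟨i, hi, hk⟩)

/-- If every read-set lies in the `d`-ball of radius `r` around its link, the read-closure of `S` lies in
the `r`-neighbourhood of `S`. -/
theorem readClosure_subset_thickening (d : ι → ι → ℕ) {N : ι → Set ι} {r : ℕ}
    (hN : ∀ i, ∀ j ∈ N i, d i j ≤ r) (S : Set ι) :
    readClosure N S ⊆ {k | ∃ i ∈ S, d i k ≤ r} := by
  intro k hk
  obtain ⟨i, hi, hk⟩ := mem_readClosure.1 hk
  exact ⟨i, hi, hN i k hk⟩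

/-- **Separated supports have disjoint read-closures.**  For a distance-like `d` (symmetric, triangle
inequality — e.g. the graph distance of links on the torus), read-sets inside `r`-balls and supports
`S`, `T` with `d i j > 2 r` for all `i ∈ S`, `j ∈ T` give disjoint read-closures. -/
theorem disjoint_readClosure_of_separated (d : ι → ι → ℕ) (hsymm : ∀ a b, d a b = d b a)
    (htri : ∀ a b c, d a c ≤ d a b + d b c) {N : ι → Set ι} {r : ℕ}
    (hN : ∀ i, ∀ j ∈ N i, d i j ≤ r) {S T : Set ι} (hsep : ∀ i ∈ S, ∀ j ∈ T, 2 * r < d i j) :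
    Disjoint (readClosure N S) (readClosure N T) := by
  rw [Set.disjoint_left]
  intro k hkS hkT
  obtain ⟨i, hi, hki⟩ := mem_readClosure.1 hkS
  obtain ⟨j, hj, hkj⟩ := mem_readClosure.1 hkT
  have h1 : d i k ≤ r := hN i k hki
  have h2 : d j k ≤ r := hN j k hkj
  have h3 : 2 * r < d i j := hsep i hi j hj
  have h4 : d i j ≤ d i k + d k j := htri i k j
  rw [hsymm k j] at h4
  omega

end ReadClosure

/-! ## Independence of disjoint coordinate blocks under the product law (from the tree) -/

section Independence

variable {ι : Type*} [Fintype ι] {α : Type*} [MeasurableSpace α]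
variable (μ₀ : Measure α) [IsProbabilityMeasure μ₀]

/-- **Independence of disjoint blocks**, `Set` supports and `Measure.pi` form: if `f` depends only on
the coordinates in `S`, `g` only on those in `T`, `S ∩ T = ∅`, both measurable, then
`∫ f g = (∫ f)(∫ g)` under `⊗_ι μ₀`.  This is the tree's
`Literature.Probability.LatticeModels.integral_mul_eq_of_dependsOn_disjoint` (finset supports,
`infinitePi`) transported along `Measure.infinitePi_eq_pi`; no integrability hypothesis (Mathlib's
`IndepFun.integral_fun_mul_eq_mul_integral` handles the junk cases). [folklore] -/
theorem integral_mul_eq_of_dependsOn_sets {S T : Set ι} (hST : Disjoint S T)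
    {f g : (ι → α) → ℝ} (hfm : Measurable f) (hgm : Measurable g)
    (hf : DependsOn f S) (hg : DependsOn g T) :
    ∫ x, f x * g x ∂Measure.pi (fun _ : ι => μ₀) =
      (∫ x, f x ∂Measure.pi (fun _ : ι => μ₀)) * ∫ x, g x ∂Measure.pi (fun _ : ι => μ₀) := by
  classical
  rw [← Measure.infinitePi_eq_pi]
  exact Literature.Probability.LatticeModels.integral_mul_eq_of_dependsOn_disjoint (fun _ : ι => μ₀)
    (S := S.toFinset) (T := T.toFinset) (Set.disjoint_toFinset.2 hST) hfm hgm (by simpa using hf)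
    (by simpa using hg)

end Independence

/-! ## PROPOSITION R — exact decorrelation beyond twice the range, and the no-go -/

section PropositionR

variable {ι : Type*} [Fintype ι] {α : Type*} [MeasurableSpace α]
variable (μ₀ : Measure α) [IsProbabilityMeasure μ₀]

/-- **PROPOSITION R (exact part).**  Let `Φ` be a measurable field map with read-sets `N`, and `A`, `B`
measurable real observables of the OUTPUT field supported on `S`, `T` whose read-closures are disjoint.
Under the push-forward `Φ_* (⊗_ι μ₀)` of the i.i.d. law, `A` and `B` are EXACTLY uncorrelated:
`∫ A B = (∫ A)(∫ B)`. -/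
theorem pushforward_integral_mul_eq {Φ : (ι → α) → (ι → α)} (hΦm : Measurable Φ) {N : ι → Set ι}
    (hΦ : ∀ i, DependsOn (fun W => Φ W i) (N i)) {A B : (ι → α) → ℝ} (hAm : Measurable A)
    (hBm : Measurable B) {S T : Set ι} (hA : DependsOn A S) (hB : DependsOn B T)
    (hdisj : Disjoint (readClosure N S) (readClosure N T)) :
    ∫ U, A U * B U ∂(Measure.pi fun _ : ι => μ₀).map Φ =
      (∫ U, A U ∂(Measure.pi fun _ : ι => μ₀).map Φ) *
        ∫ U, B U ∂(Measure.pi fun _ : ι => μ₀).map Φ := by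
  have hABm : AEStronglyMeasurable (fun U => A U * B U) ((Measure.pi fun _ : ι => μ₀).map Φ) :=
    (hAm.mul hBm).aestronglyMeasurable
  rw [integral_map hΦm.aemeasurable hABm, integral_map hΦm.aemeasurable hAm.aestronglyMeasurable,
    integral_map hΦm.aemeasurable hBm.aestronglyMeasurable]
  exact integral_mul_eq_of_dependsOn_sets μ₀ hdisj (hAm.comp hΦm) (hBm.comp hΦm)
    (DependsOn.comp_fieldMap hΦ hA) (DependsOn.comp_fieldMap hΦ hB)

/-- **PROPOSITION R (exact part, range form).**  A map of RANGE `r` (read-sets in `r`-balls of a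
symmetric `d` with the triangle inequality) pushes the i.i.d. law to a law under which observables
supported more than `2 r` apart are exactly uncorrelated. -/
theorem pushforward_integral_mul_eq_of_range (d : ι → ι → ℕ) (hsymm : ∀ a b, d a b = d b a)
    (htri : ∀ a b c, d a c ≤ d a b + d b c) {Φ : (ι → α) → (ι → α)} (hΦm : Measurable Φ)
    {N : ι → Set ι} (hΦ : ∀ i, DependsOn (fun W => Φ W i) (N i)) {r : ℕ}
    (hN : ∀ i, ∀ j ∈ N i, d i j ≤ r) {A B : (ι → α) → ℝ} (hAm : Measurable A) (hBm : Measurable B)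
    {S T : Set ι} (hA : DependsOn A S) (hB : DependsOn B T)
    (hsep : ∀ i ∈ S, ∀ j ∈ T, 2 * r < d i j) :
    ∫ U, A U * B U ∂(Measure.pi fun _ : ι => μ₀).map Φ =
      (∫ U, A U ∂(Measure.pi fun _ : ι => μ₀).map Φ) *
        ∫ U, B U ∂(Measure.pi fun _ : ι => μ₀).map Φ :=
  pushforward_integral_mul_eq μ₀ hΦm hΦ hAm hBm hA hB
    (disjoint_readClosure_of_separated d hsymm htri hN hsep)

/-- **Euler-depth form.**  `n` iterations of a measurable map whose read-sets sit in `R`-balls (for a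
`d` with `d i i = 0`, symmetry and the triangle inequality) form a range-`n R` map
(`MapLocality.dependsOn_iterate_ball`), so under `(F^[n])_* (⊗ μ₀)` observables supported more than
`2 n R` apart are exactly uncorrelated.  For the depth-`n` Euler integration of an order-`N` truncated
trivializing generator, `R = N + 1` in plaquette distance (THEORY-1 §12.5, §13.5). -/
theorem pushforward_iterate_integral_mul_eq (d : ι → ι → ℕ) (hd0 : ∀ i, d i i = 0)
    (hsymm : ∀ a b, d a b = d b a) (htri : ∀ a b c, d a c ≤ d a b + d b c)
    {F : (ι → α) → (ι → α)} (hFm : Measurable F) {N : ι → Set ι}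
    (hF : ∀ i, DependsOn (fun W => F W i) (N i)) {R : ℕ} (hN : ∀ i, ∀ j ∈ N i, d i j ≤ R) (n : ℕ)
    {A B : (ι → α) → ℝ} (hAm : Measurable A) (hBm : Measurable B) {S T : Set ι}
    (hA : DependsOn A S) (hB : DependsOn B T) (hsep : ∀ i ∈ S, ∀ j ∈ T, 2 * (n * R) < d i j) :
    ∫ U, A U * B U ∂(Measure.pi fun _ : ι => μ₀).map F^[n] =
      (∫ U, A U ∂(Measure.pi fun _ : ι => μ₀).map F^[n]) *
        ∫ U, B U ∂(Measure.pi fun _ : ι => μ₀).map F^[n] :=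
  pushforward_integral_mul_eq_of_range μ₀ d hsymm htri (hFm.iterate n)
    (N := fun i => {k | d i k ≤ n * R}) (fun i => dependsOn_iterate_ball hF d hd0 htri hN n i)
    (r := n * R) (fun _ _ hj => hj) hAm hBm hA hB hsep

/-- **PROPOSITION R (no-go).**  If the target law `π` has ONE pair of measurable observables `A`, `B`,
supported on `S`, `T` more than `2 r` apart, with non-vanishing connected correlation
`∫ A B ∂π ≠ (∫ A ∂π)(∫ B ∂π)`, then `π` is NOT the push-forward of the i.i.d. law under ANY measurable map of
range `r`.  (For the Wilson law at `β ≠ 0` on a torus of diameter `D`, plaquette–plaquette connected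
correlators are generically non-zero at every separation, so an EXACT trivializing map has range
`≥ D / 2`: exact trivialization is never strictly local.) -/
theorem ne_pushforward_of_integral_mul_ne (π : Measure (ι → α)) (d : ι → ι → ℕ)
    (hsymm : ∀ a b, d a b = d b a) (htri : ∀ a b c, d a c ≤ d a b + d b c)
    {Φ : (ι → α) → (ι → α)} (hΦm : Measurable Φ) {N : ι → Set ι}
    (hΦ : ∀ i, DependsOn (fun W => Φ W i) (N i)) {r : ℕ} (hN : ∀ i, ∀ j ∈ N i, d i j ≤ r)
    {A B : (ι → α) → ℝ} (hAm : Measurable A) (hBm : Measurable B) {S T : Set ι}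
    (hA : DependsOn A S) (hB : DependsOn B T) (hsep : ∀ i ∈ S, ∀ j ∈ T, 2 * r < d i j)
    (hcov : ∫ U, A U * B U ∂π ≠ (∫ U, A U ∂π) * ∫ U, B U ∂π) :
    π ≠ (Measure.pi fun _ : ι => μ₀).map Φ := by
  intro h
  apply hcov
  rw [h]
  exact pushforward_integral_mul_eq_of_range μ₀ d hsymm htri hΦm hΦ hN hAm hBm hA hB hsep

/-- Quantifier form of the no-go: no measurable map of range `r` trivializes `π` exactly. -/
theorem no_exact_rangeR_trivialization (π : Measure (ι → α)) (d : ι → ι → ℕ)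
    (hsymm : ∀ a b, d a b = d b a) (htri : ∀ a b c, d a c ≤ d a b + d b c) {r : ℕ}
    {A B : (ι → α) → ℝ} (hAm : Measurable A) (hBm : Measurable B) {S T : Set ι}
    (hA : DependsOn A S) (hB : DependsOn B T) (hsep : ∀ i ∈ S, ∀ j ∈ T, 2 * r < d i j)
    (hcov : ∫ U, A U * B U ∂π ≠ (∫ U, A U ∂π) * ∫ U, B U ∂π) :
    ¬ ∃ (Φ : (ι → α) → (ι → α)) (N : ι → Set ι), Measurable Φ ∧
        (∀ i, DependsOn (fun W => Φ W i) (N i)) ∧ (∀ i, ∀ j ∈ N i, d i j ≤ r) ∧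
        (Measure.pi fun _ : ι => μ₀).map Φ = π := by
  rintro ⟨Φ, N, hΦm, hΦ, hN, h⟩
  exact ne_pushforward_of_integral_mul_ne μ₀ π d hsymm htri hΦm hΦ hN hAm hBm hA hB hsep hcov h.symm

end PropositionR

/-! ## PROPOSITION R — the ε-exact version -/

section Approximate

variable {Ω : Type*} [MeasurableSpace Ω]

/-- `π` and `ν` are `ε`-CLOSE IN THE DUAL SENSE: every measurable real observable bounded by `c` has
means differing by at most `ε c` (`c ≥ 0`).  For probability measures this says that the dual (bounded-observable)
norm of `π - ν` is `≤ ε`, i.e. `ε ≥ 2 · TV(π, ν)`; it is the exactness figure an ε-exact sampler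
certifies.  (Standard dual-norm closeness; no single source.) [folklore] -/
@[folklore]
def IntegralClose (π ν : Measure Ω) (ε : ℝ) : Prop :=
  ∀ (h : Ω → ℝ) (c : ℝ), Measurable h → 0 ≤ c → (∀ x, |h x| ≤ c) →
    |∫ x, h x ∂π - ∫ x, h x ∂ν| ≤ ε * c

/-- Non-vacuity: a law is `ε`-close to itself for every `ε ≥ 0`. -/
theorem integralClose_self (π : Measure Ω) {ε : ℝ} (hε : 0 ≤ ε) : IntegralClose π π ε := by
  intro h c _ hc _
  simpa using mul_nonneg hε hc

/-- `IntegralClose` is symmetric. -/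
theorem IntegralClose.symm {π ν : Measure Ω} {ε : ℝ} (h : IntegralClose π ν ε) :
    IntegralClose ν π ε := by
  intro f c hf hc0 hc
  rw [abs_sub_comm]
  exact h f c hf hc0 hc

/-- The three-term covariance estimate (pure arithmetic): if the second moments are `ε a b`-close, the
first moments `ε a`- and `ε b`-close, the means bounded by `a`, `b`, and the comparison law factorises
(`m' = α' β'`), then `|m - α β| ≤ 3 ε a b`. -/
theorem abs_sub_mul_le_three {m α β m' α' β' ε a b : ℝ} (hm : |m - m'| ≤ ε * (a * b))
    (hα : |α - α'| ≤ ε * a) (hβ : |β - β'| ≤ ε * b) (hα' : |α'| ≤ a) (hβb : |β| ≤ b)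
    (hfac : m' = α' * β') : |m - α * β| ≤ 3 * ε * (a * b) := by
  have h1 : |α' - α| ≤ ε * a := by rwa [abs_sub_comm] at hα
  have h2 : |β' - β| ≤ ε * b := by rwa [abs_sub_comm] at hβ
  have t2 : |α'| * |β' - β| ≤ a * (ε * b) :=
    mul_le_mul hα' h2 (abs_nonneg _) ((abs_nonneg _).trans hα')
  have t3 : |α' - α| * |β| ≤ (ε * a) * b :=
    mul_le_mul h1 hβb (abs_nonneg _) ((abs_nonneg _).trans h1)
  have e : m - α * β = (m - m') + (α' * (β' - β) + (α' - α) * β) := by rw [hfac]; ring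
  rw [e]
  have s1 := abs_add_le (m - m') (α' * (β' - β) + (α' - α) * β)
  have s2 := abs_add_le (α' * (β' - β)) ((α' - α) * β)
  rw [abs_mul] at s2
  rw [abs_mul] at s2
  linarith

/-- **PROPOSITION R (ε-version, abstract).**  If `π` is `ε`-close in the dual sense to a probability law
`ν` under which `A` and `B` are exactly uncorrelated, and `|A| ≤ a`, `|B| ≤ b` are measurable, then
`|∫ A B ∂π - (∫ A ∂π)(∫ B ∂π)| ≤ 3 ε a b`. -/
theorem abs_cov_le_of_integralClose (π ν : Measure Ω) [IsProbabilityMeasure π]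
    [IsProbabilityMeasure ν] {ε : ℝ} (hclose : IntegralClose π ν ε) {A B : Ω → ℝ}
    (hAm : Measurable A) (hBm : Measurable B) {a b : ℝ} (hA : ∀ x, |A x| ≤ a) (hB : ∀ x, |B x| ≤ b)
    (hfac : ∫ x, A x * B x ∂ν = (∫ x, A x ∂ν) * ∫ x, B x ∂ν) :
    |∫ x, A x * B x ∂π - (∫ x, A x ∂π) * ∫ x, B x ∂π| ≤ 3 * ε * (a * b) := by
  obtain ⟨x₀⟩ : Nonempty Ω := nonempty_of_isProbabilityMeasure π
  have ha : 0 ≤ a := (abs_nonneg _).trans (hA x₀)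
  have hb : 0 ≤ b := (abs_nonneg _).trans (hB x₀)
  have hAB : ∀ x, |A x * B x| ≤ a * b := fun x => by
    rw [abs_mul]
    exact mul_le_mul (hA x) (hB x) (abs_nonneg _) ha
  -- `|∫ f| ≤ c` for `|f| ≤ c` under a probability law (Mathlib's `norm_integral_le_of_norm_le_const`)
  have hmean : ∀ (μ : Measure Ω) [IsProbabilityMeasure μ] (f : Ω → ℝ) (c : ℝ),
      (∀ x, |f x| ≤ c) → |∫ x, f x ∂μ| ≤ c := by
    intro μ _ f c hf
    have h := norm_integral_le_of_norm_le_const (μ := μ) (f := f) (C := c)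
      (Filter.Eventually.of_forall fun x => by simpa [Real.norm_eq_abs] using hf x)
    simpa [Real.norm_eq_abs] using h
  exact abs_sub_mul_le_three (hclose _ _ (hAm.mul hBm) (mul_nonneg ha hb) hAB)
    (hclose _ _ hAm ha hA) (hclose _ _ hBm hb hB) (hmean ν A a hA) (hmean π B b hB) hfac

variable {ι : Type*} [Fintype ι] {α : Type*} [MeasurableSpace α]
variable (μ₀ : Measure α) [IsProbabilityMeasure μ₀]

/-- **PROPOSITION R (ε-version).**  If a probability law `π` on link fields is `ε`-close in the dual
sense to the push-forward of the i.i.d. law under a measurable map `Φ` of range `r`, then every connected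
two-point function of measurable observables `|A| ≤ a`, `|B| ≤ b` supported MORE THAN `2 r` APART obeys
`|Cov_π(A, B)| ≤ 3 ε a b`. -/
theorem abs_cov_le_of_integralClose_pushforward (π : Measure (ι → α)) [IsProbabilityMeasure π]
    (d : ι → ι → ℕ) (hsymm : ∀ a b, d a b = d b a) (htri : ∀ a b c, d a c ≤ d a b + d b c)
    {Φ : (ι → α) → (ι → α)} (hΦm : Measurable Φ) {N : ι → Set ι}
    (hΦ : ∀ i, DependsOn (fun W => Φ W i) (N i)) {r : ℕ} (hN : ∀ i, ∀ j ∈ N i, d i j ≤ r)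
    {ε : ℝ} (hclose : IntegralClose π ((Measure.pi fun _ : ι => μ₀).map Φ) ε)
    {A B : (ι → α) → ℝ} (hAm : Measurable A) (hBm : Measurable B) {a b : ℝ}
    (hAa : ∀ x, |A x| ≤ a) (hBb : ∀ x, |B x| ≤ b) {S T : Set ι} (hA : DependsOn A S)
    (hB : DependsOn B T) (hsep : ∀ i ∈ S, ∀ j ∈ T, 2 * r < d i j) :
    |∫ U, A U * B U ∂π - (∫ U, A U ∂π) * ∫ U, B U ∂π| ≤ 3 * ε * (a * b) := by
  haveI : IsProbabilityMeasure ((Measure.pi fun _ : ι => μ₀).map Φ) :=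
    Measure.isProbabilityMeasure_map hΦm.aemeasurable
  exact abs_cov_le_of_integralClose π _ hclose hAm hBm hAa hBb
    (pushforward_integral_mul_eq_of_range μ₀ d hsymm htri hΦm hΦ hN hAm hBm hA hB hsep)

/-- **PROPOSITION R (range lower bound, contrapositive).**  If `π` is `ε`-close to the push-forward under
a range-`r` map and some pair of observables `|A| ≤ a`, `|B| ≤ b` on supports `S ∋ i`, `T ∋ j` has a
connected correlator EXCEEDING `3 ε a b`, then `S` and `T` are NOT `2 r`-separated: some pair of their
links is within `2 r`.  Read as a bound on the map: RANGE `r ≥ (separation of the witnesses) / 2`. -/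
theorem exists_close_pair_of_cov_gt (π : Measure (ι → α)) [IsProbabilityMeasure π]
    (d : ι → ι → ℕ) (hsymm : ∀ a b, d a b = d b a) (htri : ∀ a b c, d a c ≤ d a b + d b c)
    {Φ : (ι → α) → (ι → α)} (hΦm : Measurable Φ) {N : ι → Set ι}
    (hΦ : ∀ i, DependsOn (fun W => Φ W i) (N i)) {r : ℕ} (hN : ∀ i, ∀ j ∈ N i, d i j ≤ r)
    {ε : ℝ} (hclose : IntegralClose π ((Measure.pi fun _ : ι => μ₀).map Φ) ε)
    {A B : (ι → α) → ℝ} (hAm : Measurable A) (hBm : Measurable B) {a b : ℝ}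
    (hAa : ∀ x, |A x| ≤ a) (hBb : ∀ x, |B x| ≤ b) {S T : Set ι} (hA : DependsOn A S)
    (hB : DependsOn B T)
    (hcov : 3 * ε * (a * b) < |∫ U, A U * B U ∂π - (∫ U, A U ∂π) * ∫ U, B U ∂π|) :
    ∃ i ∈ S, ∃ j ∈ T, d i j ≤ 2 * r := by
  by_contra hcon
  have hsep : ∀ i ∈ S, ∀ j ∈ T, 2 * r < d i j :=
    fun i hi j hj => not_le.1 fun h => hcon ⟨i, hi, j, hj, h⟩
  exact (not_le.2 hcov) (abs_cov_le_of_integralClose_pushforward μ₀ π d hsymm htri hΦm hΦ hN hclose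
    hAm hBm hAa hBb hA hB hsep)

/-- **Footprint law.**  Same setting; if the two witnesses are supported AT LEAST `sep` apart and their
connected correlator dominates a quantity `m` (e.g. `m = c · exp (-sep / ξ)`, a correlation-length lower
bound) which itself exceeds `3 ε a b`, then `sep ≤ 2 r`: an `ε`-exact map needs RANGE at least half of
every separation at which the target still has connected correlations above `3 ε a b` — with
`m = c e^{-sep/ξ}` that is `2 r ≥ sep` for all `sep < ξ log (c / 3 ε a b)`, and for a depth-`n` Euler
integration of an order-`N` generator (`r = n (N + 1)`, `MapLocality`) the law
`n (N + 1) ≥ ½ · min (D, ξ log (c / 3 ε a b))` of THEORY-1 §13.5. -/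
theorem sep_le_two_mul_range (π : Measure (ι → α)) [IsProbabilityMeasure π]
    (d : ι → ι → ℕ) (hsymm : ∀ a b, d a b = d b a) (htri : ∀ a b c, d a c ≤ d a b + d b c)
    {Φ : (ι → α) → (ι → α)} (hΦm : Measurable Φ) {N : ι → Set ι}
    (hΦ : ∀ i, DependsOn (fun W => Φ W i) (N i)) {r : ℕ} (hN : ∀ i, ∀ j ∈ N i, d i j ≤ r)
    {ε : ℝ} (hclose : IntegralClose π ((Measure.pi fun _ : ι => μ₀).map Φ) ε)
    {A B : (ι → α) → ℝ} (hAm : Measurable A) (hBm : Measurable B) {a b : ℝ}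
    (hAa : ∀ x, |A x| ≤ a) (hBb : ∀ x, |B x| ≤ b) {S T : Set ι} (hA : DependsOn A S)
    (hB : DependsOn B T) {sep : ℕ} (hfar : ∀ i ∈ S, ∀ j ∈ T, sep ≤ d i j) {m : ℝ}
    (hm : m ≤ |∫ U, A U * B U ∂π - (∫ U, A U ∂π) * ∫ U, B U ∂π|) (hεm : 3 * ε * (a * b) < m) :
    sep ≤ 2 * r := by
  obtain ⟨i, hi, j, hj, hij⟩ := exists_close_pair_of_cov_gt μ₀ π d hsymm htri hΦm hΦ hN hclose hAm
    hBm hAa hBb hA hB (hεm.trans_le hm)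
  exact (hfar i hi j hj).trans hij

end Approximate

end Summit.Ventures.LatticeQCDFlow.TrivializingMaps
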